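import Mathlib
import Literature.Analysis.FluidPDE.VectorCalculus
import Literature.Analysis.FluidPDE.Vorticity
import Literature.Analysis.FluidPDE.SelfSimilar
import Literature.Analysis.FluidPDE.NSBoundedMildOseen
import Literature.Analysis.UnboundedOperators.HeatKernel
import Summits.NavierStokesRegularity.NavierStokesRegularity.Theorems.ThreadingFluxCentreJetDefs
import HarnessLib

/-!
# Crux `PoloidalLiouville` (stmt-NavierStokesRegularity-1222, wall W1), crux idea «platonic-germ-sieve» (ns-idea-15 g11, lens
# «negation»; critic V27 PASS-WITH-PRICE): the objects and typed statements of the card, Theorems-side (twin of the sketch, bodies VERBATIM)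

Definition file: the Theorems-side twin of the crux workfile `Cruxes/PoloidalLiouville/PlatonicSketch.lean` (v2: kernel glue
`octahedral_fixesNoVector`, `octahedral_preservesNoAxis`, …), in the namespace `…Theorems.PoloidalLiouville.Platonic` instead of the
sketch's `…Cruxes.PoloidalLiouville.Platonic`, so that kernel theorems under `Theorems/` can conclude the card's statements BY NAME without
importing a crux workfile (same device as `ThreadingFluxCentreJetDefs.lean`, `ThreadingFluxAzimuthalCartanDefs.lean`,
`ThreadingFluxCentreVirialDefs.lean`).  Contents, bodies verbatim against the sketch (the sketch's `local notation "E"` for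
`EuclideanSpace ℝ (Fin 3)` is spelled `CentreJet.E3`, the identical `abbrev` of `ThreadingFluxCentreJetDefs`; nothing else differs):

* symmetry classes (sketch §«Symmetry classes»): `IsEquivariant`, `FixesNoVector`, `PreservesNoAxis`, `cubeRot`, `IsCubeRotationData`,
  `octahedral` (the rotation group O of the cube as signed coordinate permutations);
* W1 in a symmetry class (sketch §«W1 in a symmetry class, and the typed negation»): `SymmetricPoloidalLiouville`, `SymmetricCounterexample`;
* the steady stratum and the sieve's conjecture: `IsSteadyNSOn` (the SKETCH'S light classical class: `C²` velocity, `C¹` pressure — on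
  `univ` this is the tree's `Literature.Analysis.FluidPDE.IsSteadyNSSolution 1 0`; it is WEAKER than `CentreJet.IsSteadyNSOn`, which asks
  `C³` velocity, hence a separate name), `SymmetricSteadyLiouville`, `OctahedralCentreRigidity` (THE SIEVE'S CONJECTURE, OPEN),
  `OctahedralVorticalGerm` (its negation), the two classical support facts `SteadyNSAnalytic`, `IrrotationalGermLiouville`;
* W2 in a symmetry class: `SymmetricWindowRigidity`.

The sketch's kernel glue is NOT twinned here (it is re-proved over these names in the sequel proof files, credited to the card).

WHAT THIS IS NOT: no statement here is asserted; typing a Prop proves nothing.  `PoloidalLiouville` (1222), `UnthreadedRigidity`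
(27585), `SymmetricPoloidalLiouville G`, `SymmetricSteadyLiouville G`, `SymmetricWindowRigidity G`, `OctahedralCentreRigidity` and NS
regularity are OPEN and untouched; information-grade (movement 0).  `--supports stmt-NavierStokesRegularity-1222 --as helper`.
Author of the statements: planner ns-idea-15 g11; filed Theorems-side by ns-wall-eng-8 g6 (cell ns-wall-extremal; 0 kit).

## References
* L. Brandolese, Space-time decay of Navier–Stokes flows invariant under rotations, Math. Ann. 329 (2004) 685–706, arXiv:math/0304436
  (polyhedral symmetry classes of NS — nearest prior art, at spatial infinity).
* G. Koch, N. Nadirashvili, G. Seregin, V. Šverák, Liouville theorems for the Navier–Stokes equations and applications, Acta Math. 203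
  (2009) 83–105, arXiv:0709.3599 (bounded ancient mild solutions; the class of `SymmetricPoloidalLiouville`).
-/

-- the summit and its single sub-problem share the name (CONVENTIONS §1)
set_option linter.dupNamespace false

noncomputable section

namespace Summit.NavierStokesRegularity.NavierStokesRegularity.Theorems.PoloidalLiouville.Platonic

open scoped BigOperators Topology MeasureTheory InnerProductSpace RealInnerProductSpace
open Filter Set Function MeasureTheory
open Summit.NavierStokesRegularity.NavierStokesRegularity.Theorems.PoloidalLiouville.CentreJet (E3)

/-! ## Symmetry classes (sketch, verbatim) -/

/-- `u` is equivariant under every map in `G` (about the origin): `u (g x) = g (u x)`. -/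
def IsEquivariant (G : Set (E3 → E3)) (u : E3 → E3) : Prop :=
  ∀ g ∈ G, ∀ x, u (g x) = g (u x)

/-- `G` fixes no nonzero vector (true for the rotation groups of the Platonic solids and for the dihedral groups;
false for cyclic groups).  This is all the W1-glue uses. -/
def FixesNoVector (G : Set (E3 → E3)) : Prop :=
  ∀ b : E3, (∀ g ∈ G, g b = b) → b = 0

/-- `G` preserves no line (irreducible on `ℝ³`: true for the tetrahedral, octahedral, icosahedral rotation groups,
false for cyclic AND dihedral groups).  This is what makes every axisymmetric mechanism void in the class. -/
def PreservesNoAxis (G : Set (E3 → E3)) : Prop :=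
  ∀ a : E3, a ≠ 0 → ∃ g ∈ G, ∀ c : ℝ, g a ≠ c • a

/-- The signed coordinate permutation `x ↦ (sᵢ · x_{σ i})ᵢ`. -/
def cubeRot (σ : Equiv.Perm (Fin 3)) (s : Fin 3 → ℝ) (x : E3) : E3 :=
  WithLp.toLp 2 (fun i => s i * x (σ i))

/-- Data of a ROTATION of the cube `{±e₀, ±e₁, ±e₂}`: signs `±1` with `sign σ · ∏ sᵢ = 1` (24 elements: the group O). -/
def IsCubeRotationData (σ : Equiv.Perm (Fin 3)) (s : Fin 3 → ℝ) : Prop :=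
  (∀ i, s i = 1 ∨ s i = -1) ∧ ((Equiv.Perm.sign σ : ℤ) : ℝ) * ∏ i, s i = 1

/-- The octahedral rotation group O as a set of self-maps of `ℝ³`. -/
def octahedral : Set (E3 → E3) :=
  {g | ∃ σ s, IsCubeRotationData σ s ∧ g = cubeRot σ s}

/-! ## W1 in a symmetry class, and the typed negation (sketch, verbatim) -/

/-- W1 (`PoloidalLiouville`, centre normalised to `0`) RESTRICTED to the `G`-equivariant class, with the conclusion it
takes there: the flow VANISHES.  OPEN for `G` = O, I (it is implied by W1: `symmetricLiouville_of_poloidalLiouville`). -/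
def SymmetricPoloidalLiouville (G : Set (E3 → E3)) : Prop :=
  ∀ v : ℝ → E3 → E3, Literature.Analysis.FluidPDE.IsBoundedAncientMildSolution 1 v →
    (∀ t < 0, AEStronglyMeasurable (v t) volume) →
    ContDiffOn ℝ (⊤ : ℕ∞) (Function.uncurry v) (Set.Iio 0 ×ˢ Set.univ) →
    (∀ t < 0, ∀ x, inner ℝ x (Literature.Analysis.FluidPDE.curl (v t) x) = 0) →
    (∀ t < 0, IsEquivariant G (v t)) →
    ∀ t < 0, ∀ x, v t x = 0

/-- The NEGATION OBJECT: a bounded ancient mild solution, smooth, unthreaded about `0`, `G`-equivariant, not identically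
zero at some negative time.  For `G` fixing no vector it refutes W1 (`not_poloidalLiouville_of_symmetricCounterexample`). -/
def SymmetricCounterexample (G : Set (E3 → E3)) : Prop :=
  ∃ v : ℝ → E3 → E3, Literature.Analysis.FluidPDE.IsBoundedAncientMildSolution 1 v ∧
    (∀ t < 0, AEStronglyMeasurable (v t) volume) ∧
    ContDiffOn ℝ (⊤ : ℕ∞) (Function.uncurry v) (Set.Iio 0 ×ˢ Set.univ) ∧
    (∀ t < 0, ∀ x, inner ℝ x (Literature.Analysis.FluidPDE.curl (v t) x) = 0) ∧
    (∀ t < 0, IsEquivariant G (v t)) ∧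
    ∃ t < 0, ∃ x, v t x ≠ 0

/-! ## The steady stratum and the sieve's conjecture (sketch, verbatim) -/

/-- Classical steady Navier–Stokes (`ν = 1`, no force) on an open set `U`.  [Twin note: this is the SKETCH'S light class — `C²`
velocity, `C¹` pressure; on `univ` it is exactly the tree's `Literature.Analysis.FluidPDE.IsSteadyNSSolution 1 0`.  It is implied by,
and strictly weaker than, `CentreJet.IsSteadyNSOn` (`C³` velocity), hence the separate name.] -/
def IsSteadyNSOn (U : Set E3) (V : E3 → E3) (p : E3 → ℝ) : Prop :=
  ContDiffOn ℝ 2 V U ∧ ContDiffOn ℝ 1 p U ∧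
    (∀ x ∈ U, Literature.Analysis.FluidPDE.VectorCalculus.divergence V x = 0) ∧
    ∀ x ∈ U, fderiv ℝ V x (V x) + gradient p x = Laplacian.laplacian V x

/-- STEADY STRATUM of W1 in the class `G` (OPEN): a bounded steady NS flow on `ℝ³`, unthreaded about `0` and
`G`-equivariant, vanishes.  For the octahedral class it follows from the local conjecture `OctahedralCentreRigidity`
and two classical facts (`octahedralSteadyLiouville_of_centreRigidity`, kernel). -/
def SymmetricSteadyLiouville (G : Set (E3 → E3)) : Prop :=
  ∀ (V : E3 → E3) (p : E3 → ℝ), IsSteadyNSOn Set.univ V p → (∃ B : ℝ, ∀ x, ‖V x‖ ≤ B) →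
    (∀ x, inner ℝ x (Literature.Analysis.FluidPDE.curl V x) = 0) → IsEquivariant G V → ∀ x, V x = 0

/-- THE SIEVE'S CONJECTURE (OPEN; local, real-analytic, purely about germs): a real-analytic steady NS germ on a ball
about `0`, unthreaded about `0` and O-equivariant, is IRROTATIONAL.  Evidence (RESULTS.md of this card, exact over ℚ):
the O-equivariant unthreaded jet cascade with vortical seed is consistent through degree 15 and meets 1 + 2 + 3
polynomial residual conditions on its two moduli at degrees 17, 19, 21.  Killable both ways by finishing that
elimination.  Irrotational O-germs exist (`∇h₄`, `∇h₆`, …) — the conclusion cannot be strengthened to `V = 0` locally. -/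
def OctahedralCentreRigidity : Prop :=
  ∀ (V : E3 → E3) (p : E3 → ℝ) (ρ : ℝ), 0 < ρ →
    AnalyticOnNhd ℝ V (Metric.ball 0 ρ) → AnalyticOnNhd ℝ p (Metric.ball 0 ρ) →
    IsSteadyNSOn (Metric.ball 0 ρ) V p →
    (∀ x ∈ Metric.ball 0 ρ, inner ℝ x (Literature.Analysis.FluidPDE.curl V x) = 0) →
    (∀ x ∈ Metric.ball 0 ρ, ∀ σ s, IsCubeRotationData σ s → cubeRot σ s x ∈ Metric.ball 0 ρ →
        V (cubeRot σ s x) = cubeRot σ s (V x)) →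
    ∀ x ∈ Metric.ball 0 ρ, Literature.Analysis.FluidPDE.curl V x = 0

/-- Its NEGATION, the counterexample GERM the negation lens hunts: an O-equivariant unthreaded steady analytic germ
with vorticity.  (A germ is not yet a bounded entire flow; it is the first object any O-symmetric counterexample to
W1's steady stratum must contain.) -/
def OctahedralVorticalGerm : Prop :=
  ∃ (V : E3 → E3) (p : E3 → ℝ) (ρ : ℝ), 0 < ρ ∧
    AnalyticOnNhd ℝ V (Metric.ball 0 ρ) ∧ AnalyticOnNhd ℝ p (Metric.ball 0 ρ) ∧
    IsSteadyNSOn (Metric.ball 0 ρ) V p ∧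
    (∀ x ∈ Metric.ball 0 ρ, inner ℝ x (Literature.Analysis.FluidPDE.curl V x) = 0) ∧
    (∀ x ∈ Metric.ball 0 ρ, ∀ σ s, IsCubeRotationData σ s → cubeRot σ s x ∈ Metric.ball 0 ρ →
        V (cubeRot σ s x) = cubeRot σ s (V x)) ∧
    ∃ x ∈ Metric.ball 0 ρ, Literature.Analysis.FluidPDE.curl V x ≠ 0

/-- CLASSICAL FACT (support, S): steady NS solutions are real-analytic in the interior. -/
def SteadyNSAnalytic : Prop :=
  ∀ (U : Set E3) (V : E3 → E3) (p : E3 → ℝ), IsOpen U → IsSteadyNSOn U V p →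
    AnalyticOnNhd ℝ V U ∧ AnalyticOnNhd ℝ p U

/-- CLASSICAL FACT (support, S): a bounded steady NS flow on `ℝ³` that is irrotational on some ball about `0` is constant
(analytic continuation of `curl V = 0`, then `ΔV = ∇ div V − curl curl V = 0` and Liouville for bounded harmonic maps). -/
def IrrotationalGermLiouville : Prop :=
  ∀ (V : E3 → E3) (p : E3 → ℝ), IsSteadyNSOn Set.univ V p → (∃ B : ℝ, ∀ x, ‖V x‖ ≤ B) →
    (∃ ρ : ℝ, 0 < ρ ∧ ∀ x ∈ Metric.ball 0 ρ, Literature.Analysis.FluidPDE.curl V x = 0) →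
    ∃ b : E3, ∀ x, V x = b

/-! ## W2 in a symmetry class (sketch, verbatim) -/

/-- W2 (`UnthreadedRigidity`, centre `0`) RESTRICTED to the `G`-class with the conclusion it takes there when `G`
preserves no axis: the window solution VANISHES.  (Glue from `UnthreadedRigidity` is NOT kernel-proved here: it needs
«the symmetry algebra of a `G`-equivariant field is `G`-conjugation invariant» and «rotations about two non-parallel axes
generate SO(3)», then «a continuous SO(3)-equivariant divergence-free field on `ℝ³` is `0`».)  OPEN. -/
def SymmetricWindowRigidity (G : Set (E3 → E3)) : Prop :=
  ∀ (S : Set ℝ), IsOpen S → IsPreconnected S → ∀ (u : ℝ → E3 → E3),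
    ContinuousOn (Function.uncurry u) (S ×ˢ Set.univ) →
    (∀ t ∈ S, Literature.Analysis.FluidPDE.VectorCalculus.IsDivFree (u t)) →
    (∀ s ∈ S, ∀ t ∈ S, s < t → ∀ x, u t x =
        Literature.Analysis.UnboundedOperators.heatExtension (u s) (t - s) x -
          Literature.Analysis.FluidPDE.oseenDuhamel 1 s u u t x) →
    (∀ τ ∈ S, ∃ B : ℝ, ∀ t ∈ S, t ≤ τ → ∀ x, ‖u t x‖ ≤ B) →
    (∀ t ∈ S, ∀ x, inner ℝ (Literature.Analysis.FluidPDE.curl (u t) x) x = 0) →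
    (∀ t ∈ S, IsEquivariant G (u t)) →
    ∀ t ∈ S, ∀ x, u t x = 0

end Summit.NavierStokesRegularity.NavierStokesRegularity.Theorems.PoloidalLiouville.Platonic

end
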